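import Summits.ResolutionOfSingularities.ResolutionOfSingularities.Theorems.HomologicalConductorNoZenoRPowerMulMap
import Literature.AlgebraicGeometry.Modules.TwistPushforwardClosedBaseChange
import Literature.AlgebraicGeometry.Modules.AffineLocalizingBiproduct
import HarnessLib

/-!
# Crux `NoZenoR` (stmt-ResolutionOfSingularities-19943) — road (R1′), step (c): Γ-generation
# `Γ(X, (IJ)𝒪_X) = Σ tᵢ · Γ(X, J𝒪_X)` from `Ȟ¹(ker Ψ) = 0` for the multiplication epimorphism `Ψ : ⨁ᵢ J𝒪_X ↠ (IJ)𝒪_X`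

Route `ResolutionOfSingularities/HomologicalConductor` (cell decomp-res, hand leafhand-res-homologicalconduct-22 g0).
OURS: AI-written, weaker than expert review; nothing here is a statement of the manuscript under review (Hironaka 2017).
SUPPORT level, counted 0.  Def-free, fact-free.

With `Ψ` the multiplication map of `…PowerMulMap.exists_epi_mulMap` (components `ιᵢ ≫ Ψ ≫ ι_{IJ} = ι_J ≫ (tᵢ ·)`,
an epimorphism) and a finite affine open cover `𝒰` of `X`: if `Ȟ¹(𝒰, ker Ψ) = 0` then `Ψ` is onto on GLOBAL sections
(tree `app_top_surjective_of_shortExact_of_subsingleton_cechMH1`, long exact Čech sequence), and a global section of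
`⨁ᵢ J𝒪_X` is the sum of its components (`biproduct.total` on sections), so every global section of `(IJ)𝒪_X` is
`Σ tᵢ · (global section of J𝒪_X)`:

* `app_sum_biproduct_ι_π` — `w = Σᵢ ιᵢ(πᵢ w)` on sections of a finite biproduct of `𝒪_X`-modules;
* `sections_generate_of_subsingleton_cechMH1_kernel` — **Γ-generation from `Ȟ¹(ker Ψ) = 0`**.

For `I = 𝔪 = (t₁,…,t_s)`, `J = 𝔪ⁿ` this is exactly the hypothesis `hgen n` of
`…ContractedSections.isIntegrallyClosed_stalk_affineBlowup_of_sections_generate`; what then remains of Prop. (8.1) is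
`Ȟ¹(𝒰, ker Ψₙ) = 0` for `n ≥ 1` (road (R1′) step (b): `ker Ψₙ` is generated by the global sections `t^β(t_jε_i − t_iε_j)`,
local algebra `…KoszulSyzygies`, plus `cechMapH1_surjective_of_isResolution_of_coh` and `Ȟ¹(𝒪_X^N) = 0`).

No crux, kill test or summit statement is proved here; resolution in positive characteristic is NOT proved.

References: J. Lipman, Publ. Math. IHÉS 36 (1969), Lemma (7.3) and its Corollary (pp. 210–211) [`Lipman1969`];
R. Hartshorne, *Algebraic Geometry* (1977), III Thm. 4.5 proof (long exact sequence) [`Hartshorne1977`].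
-/

noncomputable section

-- single-problem summit: the doubled namespace component `ResolutionOfSingularities` is forced
set_option linter.dupNamespace false
-- `TopCat.Presheaf`/`Scheme.Modules` are not reducible (as in Mathlib's `AlgebraicGeometry/Modules`).
set_option backward.isDefEq.respectTransparency false

open CategoryTheory CategoryTheory.Limits AlgebraicGeometry TopologicalSpace Opposite IsLocalRing
open Literature.AlgebraicGeometry.Morphisms Literature.AlgebraicGeometry.Modules
open Literature.AlgebraicGeometry.Resolution

namespace Summit.ResolutionOfSingularities.ResolutionOfSingularities.Theorems.NoZeno.QuadraticTransform

section Biproduct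

variable {X : Scheme.{0}}

/-- `(Σ_k φ_k).app W = Σ_k (φ_k).app W` on sections. [folklore] -/
theorem app_finset_sum {M N : X.Modules} {κ : Type} (s : Finset κ) (φ : κ → (M ⟶ N)) (W : X.Opens)
    (x : Γ(M, W)) : (∑ k ∈ s, φ k).app W x = ∑ k ∈ s, (φ k).app W x := by
  classical
  induction s using Finset.induction_on with
  | empty => simp only [Finset.sum_empty, Scheme.Modules.Hom.zero_app]; rfl
  | insert a s ha ih =>
    rw [Finset.sum_insert ha, Finset.sum_insert ha, Scheme.Modules.Hom.add_app, ← ih]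
    rfl

variable [HasFiniteBiproducts X.Modules]

/-- **A section of a finite biproduct is the sum of its components**: `w = Σᵢ ιᵢ(πᵢ w)` (`biproduct.total` on sections).
[cite: Hartshorne1977, II Ex. 1.9] -/
theorem app_sum_biproduct_ι_π {s : ℕ} (F : Fin s → X.Modules) (W : X.Opens) (w : Γ((⨁ F), W)) :
    ∑ i, (biproduct.ι F i).app W ((biproduct.π F i).app W w) = w := by
  have h := congrArg (fun φ : (⨁ F) ⟶ (⨁ F) => φ.app W w) (biproduct.total : _ = 𝟙 (⨁ F))
  simp only [app_finset_sum, Scheme.Modules.Hom.comp_app, CategoryTheory.comp_apply, Scheme.Modules.Hom.id_app] at h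
  exact h

end Biproduct

section Generate

variable {S : Type} [CommRing S] {X : Scheme.{0}} (π : X ⟶ Spec (.of S))

/-- **Γ-generation from `Ȟ¹(ker Ψ) = 0`**: for the multiplication epimorphism `Ψ : ⨁ᵢ J𝒪_X ↠ K𝒪_X` with components
`tᵢ ·` (`…PowerMulMap.exists_epi_mulMap`, `K = (t₁,…,t_s)·J`) and a finite affine open cover `𝒰` of `X` with
`Ȟ¹(𝒰, ker Ψ) = 0`, every global section of `K𝒪_X` is `Σ tᵢ · (global section of J𝒪_X)`: `Ψ` is onto on global sections
(long exact Čech sequence) and a section of the biproduct is the sum of its components.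
[cite: Lipman1969, Lemma (7.3) Corollary (p. 210); Hartshorne1977, III Thm. 4.5 (proof)] -/
theorem sections_generate_of_subsingleton_cechMH1_kernel [HasFiniteBiproducts X.Modules] {s : ℕ} (t : Fin s → S)
    (J K : Ideal S)
    (Ψ : (⨁ fun _ : Fin s => idealMul (unitModule X) (Scheme.IdealSheafData.ofIdealTop (J.map (algebraMapΓ π)))) ⟶
      idealMul (unitModule X) (Scheme.IdealSheafData.ofIdealTop (K.map (algebraMapΓ π))))
    (hΨ : ∀ i, biproduct.ι _ i ≫ Ψ ≫ idealMulι (unitModule X) _ =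
      idealMulι (unitModule X) _ ≫ globalScalar (unitModule X) (algebraMapΓ π (t i)))
    [Epi Ψ] {κ : Type} (U : κ → X.Opens) (hUaff : ∀ k, IsAffineOpen (U k)) (hUcov : ⨆ k, U k = ⊤)
    (hH1 : Subsingleton (CechMH1 π (kernel Ψ) U))
    (y : Γ(idealMul (unitModule X) (Scheme.IdealSheafData.ofIdealTop (K.map (algebraMapΓ π))), ⊤)) :
    ∃ m : Fin s → Γ(idealMul (unitModule X) (Scheme.IdealSheafData.ofIdealTop (J.map (algebraMapΓ π))), ⊤),
      (show Γ(X, ⊤) from (idealMulι (unitModule X) _).app ⊤ y) =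
        ∑ i, algebraMapΓ π (t i) * (show Γ(X, ⊤) from (idealMulι (unitModule X) _).app ⊤ (m i)) := by
  classical
  -- `0 → ker Ψ → ⨁ J𝒪_X → K𝒪_X → 0`, with affine-localizing kernel
  have hS : (ShortComplex.mk (kernel.ι Ψ) Ψ (kernel.condition _)).ShortExact :=
    ShortComplex.ShortExact.mk' (ShortComplex.exact_of_f_is_kernel _ (kernelIsKernel _)) inferInstance inferInstance
  have hJloc : IsAffineLocalizing (idealMul (unitModule X) (Scheme.IdealSheafData.ofIdealTop (J.map (algebraMapΓ π)))) :=
    isAffineLocalizing_idealMul (M := unitModule X) (J := (Scheme.IdealSheafData.ofIdealTop (J.map (algebraMapΓ π)))) IsAffineLocalizing.unit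
  have hKloc : IsAffineLocalizing (idealMul (unitModule X) (Scheme.IdealSheafData.ofIdealTop (K.map (algebraMapΓ π)))) :=
    isAffineLocalizing_idealMul (M := unitModule X) (J := (Scheme.IdealSheafData.ofIdealTop (K.map (algebraMapΓ π)))) IsAffineLocalizing.unit
  have hBloc : IsAffineLocalizing (⨁ fun _ : Fin s => idealMul (unitModule X) (Scheme.IdealSheafData.ofIdealTop (J.map (algebraMapΓ π)))) :=
    IsAffineLocalizing.biproduct _ fun _ => hJloc
  have hker : IsAffineLocalizing (kernel Ψ) := IsAffineLocalizing.kernel Ψ hBloc hKloc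
  -- `Ψ` is onto on global sections
  have hsurj : Function.Surjective (Ψ.app ⊤) :=
    app_top_surjective_of_shortExact_of_subsingleton_cechMH1 π U hUaff hUcov hS hker hH1
  obtain ⟨w, hw⟩ := hsurj y
  -- decompose `w` into components
  refine ⟨fun i => (biproduct.π (fun _ : Fin s => idealMul (unitModule X) (Scheme.IdealSheafData.ofIdealTop (J.map (algebraMapΓ π)))) i).app ⊤ w, ?_⟩
  have hcomp : ∀ (i : Fin s) (m : Γ(idealMul (unitModule X) (Scheme.IdealSheafData.ofIdealTop (J.map (algebraMapΓ π))), ⊤)),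
      (idealMulι (unitModule X) (Scheme.IdealSheafData.ofIdealTop (K.map (algebraMapΓ π)))).app ⊤
          (Ψ.app ⊤ ((biproduct.ι (fun _ : Fin s => idealMul (unitModule X) (Scheme.IdealSheafData.ofIdealTop (J.map (algebraMapΓ π)))) i).app ⊤ m)) =
        X.presheaf.map (homOfLE (le_top : (⊤ : X.Opens) ≤ ⊤)).op (algebraMapΓ π (t i)) •
          (idealMulι (unitModule X) (Scheme.IdealSheafData.ofIdealTop (J.map (algebraMapΓ π)))).app ⊤ m := by
    intro i m
    have h := congrArg (fun φ => φ.app ⊤ m) (hΨ i)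
    simp only [Scheme.Modules.Hom.comp_app, CategoryTheory.comp_apply, globalScalar_app_apply] at h
    exact h
  have hres : ∀ a : Γ(X, ⊤), X.presheaf.map (homOfLE (le_top : (⊤ : X.Opens) ≤ ⊤)).op a = a := by
    intro a
    have : (homOfLE (le_top : (⊤ : X.Opens) ≤ ⊤)).op = 𝟙 (op ⊤) := Subsingleton.elim _ _
    rw [this, X.presheaf.map_id]
    rfl
  have hsum : (show Γ(X, ⊤) from (idealMulι (unitModule X) (Scheme.IdealSheafData.ofIdealTop (K.map (algebraMapΓ π)))).app ⊤ y) =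
      ∑ i, (show Γ(X, ⊤) from (idealMulι (unitModule X) (Scheme.IdealSheafData.ofIdealTop (K.map (algebraMapΓ π)))).app ⊤
        (Ψ.app ⊤ ((biproduct.ι (fun _ : Fin s => idealMul (unitModule X) (Scheme.IdealSheafData.ofIdealTop (J.map (algebraMapΓ π)))) i).app ⊤
          ((biproduct.π (fun _ : Fin s => idealMul (unitModule X) (Scheme.IdealSheafData.ofIdealTop (J.map (algebraMapΓ π)))) i).app ⊤ w)))) := by
    conv_lhs => rw [← hw, ← app_sum_biproduct_ι_π
      (fun _ : Fin s => idealMul (unitModule X) (Scheme.IdealSheafData.ofIdealTop (J.map (algebraMapΓ π)))) ⊤ w]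
    rw [map_sum, map_sum]
  rw [hsum]
  refine Finset.sum_congr rfl fun i _ => ?_
  have h := hcomp i ((biproduct.π (fun _ : Fin s => idealMul (unitModule X)
    (Scheme.IdealSheafData.ofIdealTop (J.map (algebraMapΓ π)))) i).app ⊤ w)
  rw [hres] at h
  exact h

end Generate

end Summit.ResolutionOfSingularities.ResolutionOfSingularities.Theorems.NoZeno.QuadraticTransform

end
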